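import Literature.Geometry.Riemannian.YamabePositivity
import HarnessLib

/-!
# The Yamabe functional is bounded below on a conformal class: `Y(M,[g]) > −∞`
# (closed `4`-manifolds)

Lee–Parker 1987, §1, after (1.5): the Yamabe invariant `λ(M) = inf Q` of a conformal class on a
closed manifold is finite — by Hölder's inequality, verbatim (Lee–Parker, proof of Lemma 4.?? is
not needed; the one-line estimate of Aubin 1982, Ch. 6, §6.5, case (γ): for `g' ∈ [g]`,
`J(φ) ≥ inf(R, 0)‖φ‖₂²‖φ‖_N^{−2} ≥ inf(R,0) V^{2/n}`). The tree's `yamabeConstant`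
(`YamabeConstant.lean`) is a real `sInf`, with junk value `0` on a class whose quotients were
unbounded below, so its API lemmas `yamabeConstant_le`, `yamabeConstant_le_of_le` ("every conformal
metric bounds `Y` from above") carry the hypothesis `BddBelow (yamabeQuotients g₀)` ("always true,
Lee–Parker 1987, §1 — not proved here"), which downstream files thread as a hypothesis
(`LiQingShiPinchingProofs.lean`) or discharge ad hoc from positivity (`ChangGurskyYangPIC.lean`,
`ChangGurskyYangProofs.integral_scalarCurvature_pos_of_yamabeConstant_pos`,
`AubinYamabeSphereProofs.lean`). This file PROVES it for `C^∞` metrics on closed `4`-manifolds, in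
the metric form of the invariant (Chang–Gursky–Yang 2003, Remark 1:
`Y(M⁴,g) = inf_{g̃ ∈ [g]} vol(g̃)^{−1/2} ∫R_{g̃} dvol_{g̃}` — hypothesis (i) of their Thm. A and
Thm. 1.4 is `Y > 0`):

* `integral_sq_le_sqrt_mul_sqrt` — `∫ψ² dμ ≤ √Vol · √(∫ψ⁴ dμ)` for a continuous `ψ` and a finite
  measure (Cauchy–Schwarz, here from the pointwise `2εψ² ≤ ε²ψ⁴ + 1` with the optimal `ε`);
* `neg_mul_sqrt_le_yamabeQuotient` — **for `h ∈ [g]` on a closed `4`-manifold,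
  `Q(h) ≥ −C √Vol(M,g)` whenever `R_g ≥ −C`, `C ≥ 0`**: `h = ψ²g` with `ψ > 0` smooth
  (`contMDiff_conformalFactor_one`), `Q(h) = (∫R_gψ² + 6∫|dψ|²_g)/(∫ψ⁴)^{1/2}`
  (`totalScalarCurvature_conformal_sq`, Aubin's `J(φψ) = J'(ψ)`), the gradient term is
  non-negative and `∫R_gψ² ≥ −C∫ψ² ≥ −C√Vol(∫ψ⁴)^{1/2}`;
* `bddBelow_yamabeQuotients`, `bddBelow_yamabeQuotients_of` — **`Y(M,[g]) > −∞`**: the index set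
  of the infimum is bounded below (by `−(max |R_g|)√Vol(M,g)`), for a `C^∞` Riemannian
  `PseudoRiemannianMetric` with its Levi-Civita connection, resp. for a bundled
  `ContMDiffRiemannianMetric` (the form of `yamabeQuotients`);
* `yamabeConstant_le_yamabeQuotient`, `yamabeConstant_le_of_yamabeQuotient_le` — the API lemmas of
  `YamabeConstant.lean` with the boundedness hypothesis discharged: `Y(M,[g₀]) ≤ Q(h)` for every
  `h ∈ [g₀]` on a closed `4`-manifold.

Everything is proved; no definition and no named fact is introduced.

## References

* J. M. Lee, T. H. Parker, *The Yamabe problem*, Bull. AMS 17 (1987) 37–91, §1, (1.5) and the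
  sentence following it (`λ(M)` is finite); §3. [LeeParker1987]
* T. Aubin, *Nonlinear Analysis on Manifolds. Monge–Ampère Equations*, Springer 1982, Ch. 6,
  §6.4 (Prop.: `J(φψ) = J'(ψ)`), §6.5 (proof of the Theorem, (γ): the Hölder lower bound). [Aubin1982]
* S.-Y. A. Chang, M. J. Gursky, P. C. Yang, Publ. Math. IHÉS 98 (2003), Remark 1 after Thm. A
  (p. 107). [ChangGurskyYang2003]
-/

noncomputable section

open Bundle Set Function Filter Manifold MeasureTheory Module
open scoped Manifold ContDiff Topology ENNReal NNReal

namespace Literature.Geometry.Riemannian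

open Literature.Geometry.Lorentzian (PseudoRiemannianMetric riemannianMeasure)
open Literature.Geometry.Lorentzian.PseudoRiemannianMetric
open Literature.Geometry.Lorentzian

/-! ### Cauchy–Schwarz for `∫ψ²` against a finite measure -/

section CauchySchwarz

variable {X : Type*} [TopologicalSpace X] [CompactSpace X] [MeasurableSpace X]
  [OpensMeasurableSpace X] {μ : Measure X} [IsFiniteMeasure μ]

/-- **`∫ψ² dμ ≤ √μ(X) · √(∫ψ⁴ dμ)`** for a continuous real function on a compact space and a
finite measure (Cauchy–Schwarz for `ψ² · 1`; here from the pointwise inequality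
`2εψ² ≤ ε²ψ⁴ + 1`, integrated and optimised in `ε > 0`). [folklore] -/
theorem integral_sq_le_sqrt_mul_sqrt {ψ : X → ℝ} (hψ : Continuous ψ) :
    ∫ x, ψ x ^ 2 ∂μ ≤ Real.sqrt (μ.real univ) * Real.sqrt (∫ x, ψ x ^ 4 ∂μ) := by
  set V : ℝ := ∫ x, ψ x ^ 4 ∂μ with hV
  set vol : ℝ := μ.real univ with hvol
  set P : ℝ := ∫ x, ψ x ^ 2 ∂μ with hP
  have hV0 : 0 ≤ V := integral_nonneg fun x ↦ by positivity
  have hvol0 : 0 ≤ vol := measureReal_nonneg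
  have hint : ∀ n : ℕ, Integrable (fun x ↦ ψ x ^ n) μ := fun n ↦
    (hψ.pow n).integrable_of_hasCompactSupport (isClosed_tsupport _).isCompact
  -- the pointwise bound `2εψ² ≤ ε²ψ⁴ + 1` integrates to `2εP ≤ ε²V + vol`
  have hbound : ∀ ε : ℝ, 0 < ε → 2 * ε * P ≤ ε ^ 2 * V + vol := by
    intro ε hε
    have hpt : ∀ x, 2 * ε * ψ x ^ 2 ≤ ε ^ 2 * ψ x ^ 4 + 1 := fun x ↦ by
      nlinarith [sq_nonneg (ε * ψ x ^ 2 - 1)]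
    have hintR : Integrable (fun x ↦ ε ^ 2 * ψ x ^ 4 + 1) μ :=
      ((hint 4).const_mul _).add (integrable_const _)
    calc 2 * ε * P = ∫ x, 2 * ε * ψ x ^ 2 ∂μ := by rw [hP, integral_const_mul]
      _ ≤ ∫ x, (ε ^ 2 * ψ x ^ 4 + 1) ∂μ := integral_mono ((hint 2).const_mul _) hintR hpt
      _ = ε ^ 2 * V + vol := by
          rw [integral_add ((hint 4).const_mul _) (integrable_const _), integral_const_mul,
            integral_const, smul_eq_mul, mul_one, hV, hvol]
  -- degenerate cases and the optimal `ε = √vol/√V`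
  rcases eq_or_lt_of_le hV0 with hV00 | hVpos
  · -- `V = 0`: then `2εP ≤ vol` for every `ε > 0`, hence `P ≤ 0`
    have hle : P ≤ 0 := by
      by_contra hpos
      push Not at hpos
      have h1 := hbound ((vol + 1) / P) (by positivity)
      rw [← hV00, mul_zero, zero_add] at h1
      have h2 : 2 * ((vol + 1) / P) * P = 2 * (vol + 1) := by field_simp
      rw [h2] at h1
      linarith
    rw [← hV00, Real.sqrt_zero, mul_zero]
    exact hle
  rcases eq_or_lt_of_le hvol0 with hvol00 | hvolpos
  · -- `vol = 0`: the measure vanishes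
    have hμ : μ = 0 := by
      rw [← Measure.measure_univ_eq_zero, ← measureReal_eq_zero_iff]
      exact hvol00.symm
    have hP0 : P = 0 := by rw [hP]; simp [hμ]
    rw [hP0]
    positivity
  set ε : ℝ := Real.sqrt vol / Real.sqrt V with hε
  have hsV : 0 < Real.sqrt V := Real.sqrt_pos.2 hVpos
  have hsv : 0 < Real.sqrt vol := Real.sqrt_pos.2 hvolpos
  have hεpos : 0 < ε := div_pos hsv hsV
  have hsvol : Real.sqrt vol * Real.sqrt vol = vol := Real.mul_self_sqrt hvol0
  have hsVV : Real.sqrt V * Real.sqrt V = V := Real.mul_self_sqrt hV0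
  -- `ε² V = vol`, so `2εP ≤ 2 vol`, i.e. `P ≤ vol/ε = √vol √V`
  have hε2 : ε ^ 2 * V = vol := by
    rw [hε, div_pow, sq, sq, hsvol, hsVV]
    field_simp
  have h1 : ε * P ≤ vol := by nlinarith [hbound ε hεpos, hε2]
  have h2 : Real.sqrt vol * Real.sqrt V * ε = vol := by
    rw [hε, ← mul_div_assoc, div_eq_iff hsV.ne']
    linear_combination Real.sqrt V * hsvol
  nlinarith [h1, h2, hεpos]

end CauchySchwarz

/-! ### `Q(h) ≥ −C √Vol(M,g)` on `[g]` and `Y(M,[g]) > −∞` -/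

section BoundedBelow

variable {M : Type*} [TopologicalSpace M] [T2Space M] [SecondCountableTopology M] [CompactSpace M]
  [ChartedSpace (EuclideanSpace ℝ (Fin 4)) M] [IsManifold (𝓡 4) ∞ M]
  [MeasurableSpace M] [BorelSpace M]
  (g : PseudoRiemannianMetric (𝓡 4) ∞ (EuclideanSpace ℝ (Fin 4)) (TangentSpace (𝓡 4) : M → Type _))
  [g.HasLeviCivita]

/-- **A uniform lower bound for the Yamabe quotients of a conformal class** (Aubin 1982, Ch. 6,
§6.5 (γ); Lee–Parker 1987, §1): on a closed `4`-manifold, if `R_g ≥ −C` with `C ≥ 0`, then every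
metric `h` conformal to `g` has `Q(h) ≥ −C √Vol(M,g)`. Indeed `h = ψ² g` with `ψ > 0` smooth
(`contMDiff_conformalFactor_one`), `Q(h) = (∫R_gψ² dV_g + 6∫g⁻¹(dψ,dψ) dV_g)/(∫ψ⁴ dV_g)^{1/2}`
(`totalScalarCurvature_conformal_sq`), the gradient term is non-negative and
`∫R_gψ² ≥ −C∫ψ² ≥ −C √Vol (∫ψ⁴)^{1/2}` (`integral_sq_le_sqrt_mul_sqrt`).
[cite: Aubin1982, Ch. 6, §6.5] [cite: LeeParker1987, §1, (1.5)] -/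
theorem neg_mul_sqrt_le_yamabeQuotient (hg : g.IsRiemannian) {C : ℝ} (hC0 : 0 ≤ C)
    (hC : ∀ x, -C ≤ g.scalarCurvature x)
    (h : ContMDiffRiemannianMetric (𝓡 4) ∞ (EuclideanSpace ℝ (Fin 4)) (TangentSpace (𝓡 4) : M → Type _))
    [(ofRiemannian h).HasLeviCivita] (hconf : IsConformalTo h (g.toContMDiffRiemannianMetric hg)) :
    -C * Real.sqrt ((riemannianMeasure (g.toContMDiffRiemannianMetric hg)).real univ) ≤
      yamabeQuotient h := by
  set G₀ := g.toContMDiffRiemannianMetric hg with hG₀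
  haveI hLC : (ofRiemannian G₀).HasLeviCivita := ‹g.HasLeviCivita›
  set μ : Measure M := riemannianMeasure G₀ with hμ
  haveI : IsFiniteMeasure μ := isFiniteMeasure_riemannianMeasure G₀
  have hE : finrank ℝ (EuclideanSpace ℝ (Fin 4)) = 4 := finrank_euclideanSpace_fin
  -- `h = φ g = ψ² g` with `ψ = √φ` smooth and positive
  obtain ⟨φ, hφ⟩ := hconf
  have hφpos : ∀ x, 0 < φ x := fun x ↦ (hφ x).1
  have hconf' : ∀ (x : M) (v w : TangentSpace (𝓡 4) x),
      (ofRiemannian h).val x v w = φ x * g.val x v w := fun x v w ↦ (hφ x).2 v w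
  have hφs : ContMDiff (𝓡 4) 𝓘(ℝ, ℝ) ∞ φ := contMDiff_conformalFactor_one g (ofRiemannian h) hg hconf'
  set ψ : M → ℝ := fun x ↦ Real.sqrt (φ x) with hψdef
  have hψpos : ∀ x, 0 < ψ x := fun x ↦ Real.sqrt_pos.2 (hφpos x)
  have hψsq : ∀ x, ψ x ^ 2 = φ x := fun x ↦ Real.sq_sqrt (hφpos x).le
  have hψs : ContMDiff (𝓡 4) 𝓘(ℝ) ∞ ψ := fun x ↦
    (Real.contDiffAt_sqrt (hφpos x).ne').comp_contMDiffAt (hφs x)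
  have hconfψ : ∀ (x : M) (v w : TangentSpace (𝓡 4) x), h.inner x v w = ψ x ^ 2 * g.val x v w :=
    fun x v w ↦ by rw [hψsq]; exact (hφ x).2 v w
  have hψc : Continuous ψ := hψs.continuous
  have hψ1 : ContMDiff (𝓡 4) 𝓘(ℝ, ℝ) 1 ψ := hψs.of_le (by exact_mod_cast le_top)
  -- the Yamabe quotient of `h` through `g` and `ψ`
  obtain ⟨hT, hV⟩ := totalScalarCurvature_conformal_sq g hg h hψs hψpos hconfψ
  set Gr : ℝ := ∫ x, g.innerDual x (mvfderiv (𝓡 4) ψ x).toLinearMap (mvfderiv (𝓡 4) ψ x).toLinearMap ∂μ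
    with hGr
  set P : ℝ := ∫ x, ψ x ^ 2 ∂μ with hP
  set V : ℝ := ∫ x, ψ x ^ 4 ∂μ with hVdef
  have hI0 : ∀ x, 0 ≤ g.innerDual x (mvfderiv (𝓡 4) ψ x).toLinearMap (mvfderiv (𝓡 4) ψ x).toLinearMap :=
    fun x ↦ innerDual_self_nonneg G₀ x _
  have hGr0 : 0 ≤ Gr := integral_nonneg hI0
  have hV0 : 0 ≤ V := integral_nonneg fun x ↦ by positivity
  have hRc : Continuous g.scalarCurvature := (g.contMDiff_scalarCurvature).continuous
  -- `∫ R ψ² ≥ −C ∫ ψ²`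
  have hRψ : -C * P ≤ ∫ x, g.scalarCurvature x * ψ x ^ 2 ∂μ := by
    rw [hP, ← integral_const_mul]
    exact integral_mono ((integrable_of_continuous G₀ (hψc.pow 2)).const_mul (-C))
      (integrable_of_continuous G₀ (hRc.mul (hψc.pow 2)))
      fun x ↦ mul_le_mul_of_nonneg_right (hC x) (sq_nonneg _)
  have hTge : -C * P ≤ totalScalarCurvature h := by rw [hT]; linarith
  -- Cauchy–Schwarz: `P ≤ √vol √V`
  have hCS : P ≤ Real.sqrt (μ.real univ) * Real.sqrt V := integral_sq_le_sqrt_mul_sqrt hψc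
  -- conclusion
  rw [yamabeQuotient_eq_div_sqrt hE h, hV]
  rcases eq_or_lt_of_le hV0 with hV00 | hVpos
  · rw [← hV00, Real.sqrt_zero, div_zero]
    exact mul_nonpos_of_nonpos_of_nonneg (neg_nonpos.2 hC0) (Real.sqrt_nonneg _)
  rw [le_div_iff₀ (Real.sqrt_pos.2 hVpos)]
  have h1 : C * P ≤ C * (Real.sqrt (μ.real univ) * Real.sqrt V) :=
    mul_le_mul_of_nonneg_left hCS hC0
  linarith

/-- **`Y(M,[g]) > −∞` on a closed `4`-manifold** (Lee–Parker 1987, §1, after (1.5): the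
infimum `λ(M)` is finite): the index set `yamabeQuotients` of the infimum defining the Yamabe
constant of the class of a `C^∞` Riemannian metric `g` (with its Levi-Civita connection) is
bounded below — by `−(max_M |R_g|) √Vol(M,g)` (`neg_mul_sqrt_le_yamabeQuotient` with a bound
`|R_g| ≤ C` on the compact `M`). [cite: LeeParker1987, §1, (1.5)] [cite: Aubin1982, Ch. 6, §6.5] -/
theorem bddBelow_yamabeQuotients (hg : g.IsRiemannian) :
    BddBelow (yamabeQuotients (g.toContMDiffRiemannianMetric hg)) := by
  have hRc : Continuous g.scalarCurvature := (g.contMDiff_scalarCurvature).continuous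
  obtain ⟨C, hC⟩ := isCompact_univ.exists_bound_of_continuousOn hRc.continuousOn
  set C' : ℝ := max C 0 with hC'
  have hC'0 : 0 ≤ C' := le_max_right _ _
  have hlow : ∀ x, -C' ≤ g.scalarCurvature x := fun x ↦ by
    have h1 : |g.scalarCurvature x| ≤ C := Real.norm_eq_abs _ ▸ hC x (mem_univ x)
    have h2 : -C ≤ g.scalarCurvature x := (abs_le.1 h1).1
    have h3 : C ≤ C' := le_max_left _ _
    linarith
  refine ⟨-C' * Real.sqrt ((riemannianMeasure (g.toContMDiffRiemannianMetric hg)).real univ), ?_⟩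
  rintro q ⟨h, hLC, hhc, rfl⟩
  exact neg_mul_sqrt_le_yamabeQuotient g hg hC'0 hlow h hhc

omit [g.HasLeviCivita] in
/-- **`Y(M,[g₀]) > −∞`, bundled form**: for a `C^∞` Riemannian metric `g₀` (Mathlib's
`ContMDiffRiemannianMetric`, with the Levi-Civita connection of `ofRiemannian g₀`) on a closed
`4`-manifold, `yamabeQuotients g₀` is bounded below — the hypothesis `BddBelow (yamabeQuotients g₀)`
of `yamabeConstant_le` / `yamabeConstant_le_of_le` (`YamabeConstant.lean`), discharged.
[cite: LeeParker1987, §1, (1.5)] -/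
theorem bddBelow_yamabeQuotients_of
    (g₀ : ContMDiffRiemannianMetric (𝓡 4) ∞ (EuclideanSpace ℝ (Fin 4)) (TangentSpace (𝓡 4) : M → Type _))
    [(ofRiemannian g₀).HasLeviCivita] : BddBelow (yamabeQuotients g₀) :=
  bddBelow_yamabeQuotients (ofRiemannian g₀) (isRiemannian_ofRiemannian g₀)

omit [g.HasLeviCivita] in
/-- **`Y(M,[g₀]) ≤ Q(h)` for every `h ∈ [g₀]`** on a closed `4`-manifold — `yamabeConstant_le` with
its boundedness hypothesis discharged by `bddBelow_yamabeQuotients_of`. In particular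
`Y(M,[g₀]) ≤ Q(g₀)`. [cite: LeeParker1987, §1, (1.5)] -/
theorem yamabeConstant_le_yamabeQuotient
    {g₀ : ContMDiffRiemannianMetric (𝓡 4) ∞ (EuclideanSpace ℝ (Fin 4)) (TangentSpace (𝓡 4) : M → Type _)}
    [(ofRiemannian g₀).HasLeviCivita]
    (h : ContMDiffRiemannianMetric (𝓡 4) ∞ (EuclideanSpace ℝ (Fin 4)) (TangentSpace (𝓡 4) : M → Type _))
    [(ofRiemannian h).HasLeviCivita] (hc : IsConformalTo h g₀) :
    yamabeConstant g₀ ≤ yamabeQuotient h :=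
  yamabeConstant_le (bddBelow_yamabeQuotients_of g₀) h hc

omit [g.HasLeviCivita] in
/-- `Y(M,[g₀]) ≤ c` as soon as some `h ∈ [g₀]` has `Q(h) ≤ c`, on a closed `4`-manifold
(`yamabeConstant_le_of_le`, boundedness discharged). [cite: LeeParker1987, §1, (1.5)] -/
theorem yamabeConstant_le_of_yamabeQuotient_le
    {g₀ : ContMDiffRiemannianMetric (𝓡 4) ∞ (EuclideanSpace ℝ (Fin 4)) (TangentSpace (𝓡 4) : M → Type _)}
    [(ofRiemannian g₀).HasLeviCivita] {c : ℝ}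
    (h : ContMDiffRiemannianMetric (𝓡 4) ∞ (EuclideanSpace ℝ (Fin 4)) (TangentSpace (𝓡 4) : M → Type _))
    [(ofRiemannian h).HasLeviCivita] (hc : IsConformalTo h g₀) (hq : yamabeQuotient h ≤ c) :
    yamabeConstant g₀ ≤ c :=
  (yamabeConstant_le_yamabeQuotient h hc).trans hq

end BoundedBelow

end Literature.Geometry.Riemannian

end
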